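import Summits.CriticalPhenomena.PercolationContinuityZ3.Theses.PercNearOneGluing
import Summits.CriticalPhenomena.PercolationContinuityZ3.Theorems.PercNearOneGluingAdditiveGluingGoodStepResidual
import Summits.CriticalPhenomena.PercolationContinuityZ3.Theorems.PercNearOneGluingAdditiveGluingGoodStep
import Summits.CriticalPhenomena.PercolationContinuityZ3.Theorems.PercNearOneGluingAdditiveGluingGoodBase
import Summits.CriticalPhenomena.PercolationContinuityZ3.Theorems.PercNearOneGluingAdditiveGluingLemma5AnyRelay
import Summits.CriticalPhenomena.PercolationContinuityZ3.Theorems.PercNearOneGluingAdditiveGluingPeelOfPairForm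
import Summits.CriticalPhenomena.PercolationContinuityZ3.Theorems.PercNearOneGluingAdditiveGluingPeelPairGamma
import Summits.CriticalPhenomena.PercolationContinuityZ3.Theorems.PercNearOneGluingAdditiveGluingVariants22625
import HarnessLib

/-! # Crux `PercNearOneGluing.AdditiveGluing` (stmt-CriticalPhenomena-4576): **the crux follows from ONE inequality, `pairGamma`**

TTRL deep seat `prover-ttrlatt-v22472-d0-0` (variant V22472 = `stub_peel`); lands `--supports stmt-CriticalPhenomena-4576`.
No definitions, no named facts.  CONDITIONAL result: every theorem takes `hR : pairGamma` (spelled out in each statement).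

This is the composition of line `peel` (planner skeleton `Cruxes/AdditiveGluing/Lines/peel.lean`, control-strategist seat g2:
`blockGood_of_peel`, `goodStep_of_peel`, `good_all_of_peel`, `AdditiveGluing_of` — real proofs copied VERBATIM, only the three
stub hypotheses replaced), fed with
* `pairStep_of_pairGamma hR` (landed, `…PeelPairGamma.lean`) for the pair stub `stub_ratioMonotonePair`,
* `stub_peel_of_gluedPairForm` applied to `hR` (landed, `…PeelOfPairForm.lean`: the gluing transfer) for `stub_peel`,
* the landed theorem `stub_goodStaysGoodBlock_var22625` (seat v22625) for `stub_goodStaysGoodBlock`.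
Hence `peelLine_additiveGluing_of : pairGamma → AdditiveGluing` (registered stub `stub_additiveGluingOfPairGamma_v22472`), where
`pairGamma` is the Kozma–Nitzan-type pair inequality for a POINT `s` in the glued weighting `u/T`, designated at the minimiser
of the UN-GLUED `u`; its one-relay case is proved (`peel_oneRelay`). [cite: KozmaNitzan2024, §3.2 pp. 12–14, §5.3 p. 34, Question 9 p. 36]
-/

namespace Summit.CriticalPhenomena.PercolationContinuityZ3.Theorems

open MeasureTheory Set
open Literature.Probability.LatticeModels (prodBernoulli)
open Literature.Probability.Percolation (BondConfig openConn openConnIn openGraph openCluster)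
open scoped BigOperators Classical

noncomputable section

section PeelAssembly

variable {n : ℕ}

/-- **Block goodness from `pairGamma` and goodness of one point of the block** (strong induction on the size of a sub-block
`T ∋ s`; base `|T| = 2` = the pair step; step PEEL when `D_T > 0`, goodStaysGood when `D_T ≤ 0`).  Proof verbatim from the
skeleton's `blockGood_of_peel`. [cite: KozmaNitzan2024, §3.2 pp. 12–14] -/
theorem peelLine_blockGood (u : Sym2 (Fin n) → unitInterval) (A S : Finset (Fin n)) (b a₀ s : Fin n)
    (sel : Finset (Fin n) → Fin n) (hb : b ∈ A) (hsel : ∀ W, sel W ∈ A) (hSA : Disjoint S A) (hs : s ∈ S) (h2 : 2 ≤ S.card)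
    (ha₀ : a₀ ∈ A)
    (hmin : ∀ a ∈ A, (prodBernoulli u).real (openConn a₀ b) ≤ (prodBernoulli u).real (openConn a b))
    (hbad : ∀ v ∈ S, (prodBernoulli u).real (openConn v b) < (prodBernoulli u).real (openConn a₀ b))
    (hR : ∀ (n : ℕ) (u : Sym2 (Fin n) → unitInterval) (A T : Finset (Fin n)) (b a₀ x s : Fin n) (hb : b ∈ A), Disjoint T A → x ∉ A → x ∉ T → a₀ ∈ A → s ∈ T → (∀ a ∈ A, (prodBernoulli u).real (openConn a₀ b) ≤ (prodBernoulli u).real (openConn a b)) → (prodBernoulli u).real (⋃ v ∈ T, openConn v b) < (prodBernoulli u).real (openConn a₀ b) + (prodBernoulli u).real ((openConn a₀ b)ᶜ ∩ (⋃ v ∈ T, openConn a₀ v) ∩ (⋃ v ∈ T, openConn v b)) → ((prodBernoulli (fun e : Sym2 (Fin n) => if (∀ y ∈ e, y ∈ T) ∧ ¬ e.IsDiag then 1 else u e)).real (openConn s b) + (∑ W ∈ (Finset.univ : Finset (Finset (Fin n))).filter (fun W => s ∈ W ∧ Disjoint W A), (prodBernoulli (fun e : Sym2 (Fin n) => if (∀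 y ∈ e, y ∈ T) ∧ ¬ e.IsDiag then 1 else u e)).real {ω : BondConfig (Fin n) | openCluster ω s = (W : Set (Fin n))} * A.inf' ⟨b, hb⟩ (fun a => (prodBernoulli (fun e : Sym2 (Fin n) => if (∀ y ∈ e, y ∈ T) ∧ ¬ e.IsDiag then 1 else u e)).real (openConnIn ((W : Set (Fin n))ᶜ) a b))) - (prodBernoulli (fun e : Sym2 (Fin n) => if (∀ y ∈ e, y ∈ T) ∧ ¬ e.IsDiag then 1 else u e)).real (openConn a₀ b)) * (∑ W ∈ (Finset.univ : Finset (Finset (Fin n))).filter (fun W => Disjoint W A), (prodBernoulli (fun e : Sym2 (Fin n) => if (∀ y ∈ e, y ∈ T) ∧ ¬ e.IsDiag then 1 else u e)).real {ω : BondConfig (Fin n) | ∀ z : Fin n, (z ∈ W ↔ ω ∈ ⋃ v ∈ ({s, x} : Finset (Fin n)), openConn v z)} * A.inf' ⟨b, hb⟩ (fun a => (prodBernoulli (fun e : Sym2 (Fin n) => if (∀ y ∈ e, y ∈ T) ∧ ¬ e.IsDiag then 1 else u e)).real (openConnIn ((W : Set (Fin n))ᶜ) a b))) ≤ ((prodBernoulli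 (fun e : Sym2 (Fin n) => if (∀ y ∈ e, y ∈ T) ∧ ¬ e.IsDiag then 1 else u e)).real (⋃ v ∈ ({s, x} : Finset (Fin n)), openConn v b) + (∑ W ∈ (Finset.univ : Finset (Finset (Fin n))).filter (fun W => Disjoint W A), (prodBernoulli (fun e : Sym2 (Fin n) => if (∀ y ∈ e, y ∈ T) ∧ ¬ e.IsDiag then 1 else u e)).real {ω : BondConfig (Fin n) | ∀ z : Fin n, (z ∈ W ↔ ω ∈ ⋃ v ∈ ({s, x} : Finset (Fin n)), openConn v z)} * A.inf' ⟨b, hb⟩ (fun a => (prodBernoulli (fun e : Sym2 (Fin n) => if (∀ y ∈ e, y ∈ T) ∧ ¬ e.IsDiag then 1 else u e)).real (openConnIn ((W : Set (Fin n))ᶜ) a b))) - (prodBernoulli (fun e : Sym2 (Fin n) => if (∀ y ∈ e, y ∈ T) ∧ ¬ e.IsDiag then 1 else u e)).real (openConn a₀ b) - (prodBernoulli (fun e : Sym2 (Fin n) => if (∀ y ∈ e, y ∈ T) ∧ ¬ e.IsDiag then 1 else u e)).real ((openConn a₀ b)ᶜ ∩ (⋃ v ∈ ({s, x} : Finset (Fin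 n)), openConn a₀ v) ∩ (⋃ v ∈ ({s, x} : Finset (Fin n)), openConn v b))) * (∑ W ∈ (Finset.univ : Finset (Finset (Fin n))).filter (fun W => s ∈ W ∧ Disjoint W A), (prodBernoulli (fun e : Sym2 (Fin n) => if (∀ y ∈ e, y ∈ T) ∧ ¬ e.IsDiag then 1 else u e)).real {ω : BondConfig (Fin n) | openCluster ω s = (W : Set (Fin n))} * A.inf' ⟨b, hb⟩ (fun a => (prodBernoulli (fun e : Sym2 (Fin n) => if (∀ y ∈ e, y ∈ T) ∧ ¬ e.IsDiag then 1 else u e)).real (openConnIn ((W : Set (Fin n))ᶜ) a b))))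
    (hgood : (∀ (t : ℝ) (sel' : Finset (Fin n) → Fin n), (∀ W, sel' W ∈ A) →
      (∀ a ∈ A, 1 - t ≤ (prodBernoulli u).real (openConn a b)) →
      (prodBernoulli u).real ((⋃ a ∈ A, openConn s a) ∩ (openConn s b)ᶜ)
        + ∑ W ∈ (Finset.univ : Finset (Finset (Fin n))).filter (fun W => s ∈ W ∧ Disjoint W A),
            (prodBernoulli u).real {ω : BondConfig (Fin n) | openCluster ω s = (W : Set (Fin n))}
              * (prodBernoulli u).real (openConnIn ((W : Set (Fin n))ᶜ) (sel' W) b)ᶜ ≤ t)) :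
    (prodBernoulli u).real (openConn a₀ b)
        + (prodBernoulli u).real
              ((openConn a₀ b)ᶜ ∩ (⋃ v ∈ S, openConn a₀ v) ∩ (⋃ v ∈ S, openConn v b))
      ≤ (prodBernoulli u).real (⋃ v ∈ S, openConn v b)
        + ∑ W ∈ (Finset.univ : Finset (Finset (Fin n))).filter (fun W => Disjoint W A),
            (prodBernoulli u).real {ω : BondConfig (Fin n) | ∀ z : Fin n, (z ∈ W ↔ ω ∈ ⋃ v ∈ S, openConn v z)}
              * (prodBernoulli u).real (openConnIn ((W : Set (Fin n))ᶜ) (sel W) b) := by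
  have hpair := pairStep_of_pairGamma hR
  have hpeel := stub_peel_of_gluedPairForm (fun n u A T b a₀ x s hb hTA _ hxA hxT ha₀ hs hmin hbad =>
    hR n u A T b a₀ x s hb hTA hxA hxT ha₀ hs hmin hbad)
  have hgsg := stub_goodStaysGoodBlock_var22625
  -- goodness of the point `s` with the worst selection, in success form (as in `blockGood_of_ratio`)
  have hex : ∀ W : Finset (Fin n), ∃ a, a ∈ A ∧
      A.inf' ⟨b, hb⟩ (fun a => (prodBernoulli u).real (openConnIn ((W : Set (Fin n))ᶜ) a b)) =
        (prodBernoulli u).real (openConnIn ((W : Set (Fin n))ᶜ) a b) :=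
    fun W => Finset.exists_mem_eq_inf' ⟨b, hb⟩ _
  choose selm hselmA hselm using hex
  have hpt := hgood (1 - (prodBernoulli u).real (openConn a₀ b)) selm hselmA (fun a ha => by linarith [hmin a ha])
  rw [goodStep24_functional_eq u A s b hb selm] at hpt
  have hZpt_eq : ∑ W ∈ (Finset.univ : Finset (Finset (Fin n))).filter (fun W => s ∈ W ∧ Disjoint W A),
      (prodBernoulli u).real {ω : BondConfig (Fin n) | openCluster ω s = (W : Set (Fin n))}
        * (prodBernoulli u).real (openConnIn ((W : Set (Fin n))ᶜ) (selm W) b) = (∑ W ∈ (Finset.univ : Finset (Finset (Fin n))).filter (fun W => s ∈ W ∧ Disjoint W A),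
              (prodBernoulli u).real {ω : BondConfig (Fin n) | openCluster ω s = (W : Set (Fin n))}
                * A.inf' ⟨b, hb⟩ (fun a => (prodBernoulli u).real (openConnIn ((W : Set (Fin n))ᶜ) a b))) := by
    refine Finset.sum_congr rfl fun W _ => ?_
    rw [hselm W]
  rw [hZpt_eq] at hpt
  have hKpt : 0 ≤ (prodBernoulli u).real (openConn s b) + (∑ W ∈ (Finset.univ : Finset (Finset (Fin n))).filter (fun W => s ∈ W ∧ Disjoint W A),
              (prodBernoulli u).real {ω : BondConfig (Fin n) | openCluster ω s = (W : Set (Fin n))}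
                * A.inf' ⟨b, hb⟩ (fun a => (prodBernoulli u).real (openConnIn ((W : Set (Fin n))ᶜ) a b))) - (prodBernoulli u).real (openConn a₀ b) := by
    linarith
  have hinf_nonneg : ∀ W : Finset (Fin n),
      0 ≤ A.inf' ⟨b, hb⟩ (fun a => (prodBernoulli u).real (openConnIn ((W : Set (Fin n))ᶜ) a b)) :=
    fun W => Finset.le_inf' _ _ fun a _ => measureReal_nonneg
  have hZnn : ∀ T : Finset (Fin n), 0 ≤ (∑ W ∈ (Finset.univ : Finset (Finset (Fin n))).filter (fun W => Disjoint W A),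
              (prodBernoulli u).real
                  {ω : BondConfig (Fin n) | ∀ z : Fin n, (z ∈ W ↔ ω ∈ ⋃ v ∈ T, openConn v z)}
                * A.inf' ⟨b, hb⟩ (fun a => (prodBernoulli u).real (openConnIn ((W : Set (Fin n))ᶜ) a b))) :=
    fun T => Finset.sum_nonneg fun W _ => mul_nonneg measureReal_nonneg (hinf_nonneg W)
  -- the chain: every sub-block `T ∋ s` of `S` with at least two vertices is good (worst selection)
  have hchain : ∀ (m : ℕ) (T : Finset (Fin n)), T ⊆ S → s ∈ T → 2 ≤ T.card → T.card = m →
      (prodBernoulli u).real (openConn a₀ b)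
          + (prodBernoulli u).real
              ((openConn a₀ b)ᶜ ∩ (⋃ v ∈ T, openConn a₀ v) ∩ (⋃ v ∈ T, openConn v b))
        ≤ (prodBernoulli u).real (⋃ v ∈ T, openConn v b)
          + (∑ W ∈ (Finset.univ : Finset (Finset (Fin n))).filter (fun W => Disjoint W A),
              (prodBernoulli u).real
                  {ω : BondConfig (Fin n) | ∀ z : Fin n, (z ∈ W ↔ ω ∈ ⋃ v ∈ T, openConn v z)}
                * A.inf' ⟨b, hb⟩ (fun a => (prodBernoulli u).real (openConnIn ((W : Set (Fin n))ᶜ) a b))) := by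
    intro m
    induction m using Nat.strong_induction_on with
    | _ m ih =>
      intro T hTS hsT hT2 hTm
      have hTA : Disjoint T A := Finset.disjoint_of_subset_left hTS hSA
      by_cases hT3 : T.card = 2
      · -- base: the pair step from the point `s`
        have hRM := hpair n u A T b a₀ s hb hTA hsT ha₀ hmin (fun v hv => hbad v (hTS hv)) hT3
        have hZpt_pos_or := hKpt
        by_contra hneg
        push Not at hneg
        have hZpt_pos : 0 < (∑ W ∈ (Finset.univ : Finset (Finset (Fin n))).filter (fun W => s ∈ W ∧ Disjoint W A),
              (prodBernoulli u).real {ω : BondConfig (Fin n) | openCluster ω s = (W : Set (Fin n))}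
                * A.inf' ⟨b, hb⟩ (fun a => (prodBernoulli u).real (openConnIn ((W : Set (Fin n))ᶜ) a b))) := by
          linarith [hbad s hs]
        have h1 : ((prodBernoulli u).real (⋃ v ∈ T, openConn v b)
            + (∑ W ∈ (Finset.univ : Finset (Finset (Fin n))).filter (fun W => Disjoint W A),
              (prodBernoulli u).real
                  {ω : BondConfig (Fin n) | ∀ z : Fin n, (z ∈ W ↔ ω ∈ ⋃ v ∈ T, openConn v z)}
                * A.inf' ⟨b, hb⟩ (fun a => (prodBernoulli u).real (openConnIn ((W : Set (Fin n))ᶜ) a b)))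
            - (prodBernoulli u).real (openConn a₀ b)
            - (prodBernoulli u).real
              ((openConn a₀ b)ᶜ ∩ (⋃ v ∈ T, openConn a₀ v) ∩ (⋃ v ∈ T, openConn v b))) * (∑ W ∈ (Finset.univ : Finset (Finset (Fin n))).filter (fun W => s ∈ W ∧ Disjoint W A),
              (prodBernoulli u).real {ω : BondConfig (Fin n) | openCluster ω s = (W : Set (Fin n))}
                * A.inf' ⟨b, hb⟩ (fun a => (prodBernoulli u).real (openConnIn ((W : Set (Fin n))ᶜ) a b))) < 0 :=
          mul_neg_of_neg_of_pos (by linarith) hZpt_pos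
        have h2 : 0 ≤ ((prodBernoulli u).real (openConn s b) + (∑ W ∈ (Finset.univ : Finset (Finset (Fin n))).filter (fun W => s ∈ W ∧ Disjoint W A),
              (prodBernoulli u).real {ω : BondConfig (Fin n) | openCluster ω s = (W : Set (Fin n))}
                * A.inf' ⟨b, hb⟩ (fun a => (prodBernoulli u).real (openConnIn ((W : Set (Fin n))ᶜ) a b))) - (prodBernoulli u).real (openConn a₀ b)) * (∑ W ∈ (Finset.univ : Finset (Finset (Fin n))).filter (fun W => Disjoint W A),
              (prodBernoulli u).real
                  {ω : BondConfig (Fin n) | ∀ z : Fin n, (z ∈ W ↔ ω ∈ ⋃ v ∈ T, openConn v z)}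
                * A.inf' ⟨b, hb⟩ (fun a => (prodBernoulli u).real (openConnIn ((W : Set (Fin n))ᶜ) a b))) :=
          mul_nonneg hKpt (hZnn T)
        linarith
      · -- step: remove a vertex `x ≠ s` and grow it back
        have hT3' : 3 ≤ T.card := by omega
        obtain ⟨x, hx⟩ : ∃ x, x ∈ T.erase s :=
          Finset.card_pos.1 (by rw [Finset.card_erase_of_mem hsT]; omega)
        have hxT : x ∈ T := Finset.mem_of_mem_erase hx
        have hxs : x ≠ s := Finset.ne_of_mem_erase hx
        have hsub : T.erase x ⊆ S := (Finset.erase_subset x T).trans hTS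
        have hsT' : s ∈ T.erase x := Finset.mem_erase.2 ⟨hxs.symm, hsT⟩
        have hcard' : (T.erase x).card = T.card - 1 := Finset.card_erase_of_mem hxT
        have hT2' : 2 ≤ (T.erase x).card := by omega
        have IH := ih (T.card - 1) (by omega) (T.erase x) hsub hsT' hT2' hcard'
        have hTA' : Disjoint (T.erase x) A := Finset.disjoint_of_subset_left hsub hSA
        have hxA : x ∉ A := Finset.disjoint_left.1 hSA (hTS hxT)
        have hxT' : x ∉ T.erase x := Finset.notMem_erase x T
        have ha₀T' : a₀ ∉ T.erase x := fun h => Finset.disjoint_left.1 hTA' h ha₀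
        have hins : insert x (T.erase x) = T := Finset.insert_erase hxT
        by_cases hD : (prodBernoulli u).real (⋃ v ∈ T.erase x, openConn v b)
            < (prodBernoulli u).real (openConn a₀ b)
              + (prodBernoulli u).real
              ((openConn a₀ b)ᶜ ∩ (⋃ v ∈ T.erase x, openConn a₀ v) ∩ (⋃ v ∈ T.erase x, openConn v b))
        · -- PEEL
          have hP := hpeel n u A (T.erase x) b a₀ x hb hTA' hT2' hxA hxT' ha₀ hmin hD
          rw [hins] at hP
          -- `Z_{T'} ≥ D_{T'} > 0`
          have hZpos : 0 < (∑ W ∈ (Finset.univ : Finset (Finset (Fin n))).filter (fun W => Disjoint W A),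
              (prodBernoulli u).real
                  {ω : BondConfig (Fin n) | ∀ z : Fin n, (z ∈ W ↔ ω ∈ ⋃ v ∈ T.erase x, openConn v z)}
                * A.inf' ⟨b, hb⟩ (fun a => (prodBernoulli u).real (openConnIn ((W : Set (Fin n))ᶜ) a b))) := by
            linarith
          by_contra hneg
          push Not at hneg
          -- `D_T · Z_{T'} ≤ D_{T'} · Z_T ≤ Z_{T'} · Z_T`, contradiction with `D_T > Z_T`
          have h3 : ((prodBernoulli u).real (openConn a₀ b)
              + (prodBernoulli u).real
              ((openConn a₀ b)ᶜ ∩ (⋃ v ∈ T.erase x, openConn a₀ v) ∩ (⋃ v ∈ T.erase x, openConn v b))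
              - (prodBernoulli u).real (⋃ v ∈ T.erase x, openConn v b)) * (∑ W ∈ (Finset.univ : Finset (Finset (Fin n))).filter (fun W => Disjoint W A),
              (prodBernoulli u).real
                  {ω : BondConfig (Fin n) | ∀ z : Fin n, (z ∈ W ↔ ω ∈ ⋃ v ∈ T, openConn v z)}
                * A.inf' ⟨b, hb⟩ (fun a => (prodBernoulli u).real (openConnIn ((W : Set (Fin n))ᶜ) a b)))
              ≤ (∑ W ∈ (Finset.univ : Finset (Finset (Fin n))).filter (fun W => Disjoint W A),
              (prodBernoulli u).real
                  {ω : BondConfig (Fin n) | ∀ z : Fin n, (z ∈ W ↔ ω ∈ ⋃ v ∈ T.erase x, openConn v z)}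
                * A.inf' ⟨b, hb⟩ (fun a => (prodBernoulli u).real (openConnIn ((W : Set (Fin n))ᶜ) a b))) * (∑ W ∈ (Finset.univ : Finset (Finset (Fin n))).filter (fun W => Disjoint W A),
              (prodBernoulli u).real
                  {ω : BondConfig (Fin n) | ∀ z : Fin n, (z ∈ W ↔ ω ∈ ⋃ v ∈ T, openConn v z)}
                * A.inf' ⟨b, hb⟩ (fun a => (prodBernoulli u).real (openConnIn ((W : Set (Fin n))ᶜ) a b))) :=
            mul_le_mul_of_nonneg_right (by linarith) (hZnn T)
          have h4 : (∑ W ∈ (Finset.univ : Finset (Finset (Fin n))).filter (fun W => Disjoint W A),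
              (prodBernoulli u).real
                  {ω : BondConfig (Fin n) | ∀ z : Fin n, (z ∈ W ↔ ω ∈ ⋃ v ∈ T.erase x, openConn v z)}
                * A.inf' ⟨b, hb⟩ (fun a => (prodBernoulli u).real (openConnIn ((W : Set (Fin n))ᶜ) a b))) * (∑ W ∈ (Finset.univ : Finset (Finset (Fin n))).filter (fun W => Disjoint W A),
              (prodBernoulli u).real
                  {ω : BondConfig (Fin n) | ∀ z : Fin n, (z ∈ W ↔ ω ∈ ⋃ v ∈ T, openConn v z)}
                * A.inf' ⟨b, hb⟩ (fun a => (prodBernoulli u).real (openConnIn ((W : Set (Fin n))ᶜ) a b)))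
              < ((prodBernoulli u).real (openConn a₀ b)
              + (prodBernoulli u).real
              ((openConn a₀ b)ᶜ ∩ (⋃ v ∈ T, openConn a₀ v) ∩ (⋃ v ∈ T, openConn v b))
              - (prodBernoulli u).real (⋃ v ∈ T, openConn v b)) * (∑ W ∈ (Finset.univ : Finset (Finset (Fin n))).filter (fun W => Disjoint W A),
              (prodBernoulli u).real
                  {ω : BondConfig (Fin n) | ∀ z : Fin n, (z ∈ W ↔ ω ∈ ⋃ v ∈ T.erase x, openConn v z)}
                * A.inf' ⟨b, hb⟩ (fun a => (prodBernoulli u).real (openConnIn ((W : Set (Fin n))ᶜ) a b))) := by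
            rw [mul_comm]
            exact mul_lt_mul_of_pos_right (by linarith) hZpos
          linarith
        · -- good stays good
          push Not at hD
          have hG := hgsg n u (T.erase x) b a₀ x ha₀T' hD
          rw [hins] at hG
          linarith [hZnn T]
  have hS := hchain S.card S (subset_refl S) hs h2 rfl
  -- compare the worst selection with `sel`
  have hsel_le : (∑ W ∈ (Finset.univ : Finset (Finset (Fin n))).filter (fun W => Disjoint W A),
              (prodBernoulli u).real
                  {ω : BondConfig (Fin n) | ∀ z : Fin n, (z ∈ W ↔ ω ∈ ⋃ v ∈ S, openConn v z)}
                * A.inf' ⟨b, hb⟩ (fun a => (prodBernoulli u).real (openConnIn ((W : Set (Fin n))ᶜ) a b))) ≤ ∑ W ∈ (Finset.univ : Finset (Finset (Fin n))).filter (fun W => Disjoint W A),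
      (prodBernoulli u).real {ω : BondConfig (Fin n) | ∀ z : Fin n, (z ∈ W ↔ ω ∈ ⋃ v ∈ S, openConn v z)}
        * (prodBernoulli u).real (openConnIn ((W : Set (Fin n))ᶜ) (sel W) b) := by
    refine Finset.sum_le_sum fun W _ => mul_le_mul_of_nonneg_left ?_ measureReal_nonneg
    exact Finset.inf'_le _ (hsel W)
  linarith


/-- **The inductive step `stub_goodStep` from `pairGamma`** (`goodStep24_main`; un-gluing H3; the residue by `peelLine_blockGood`
with the induction hypothesis for a point of the block).  Proof verbatim from the skeleton's `goodStep_of_peel`.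
[cite: KozmaNitzan2024, §3.2 pp. 12–14] -/
theorem peelLine_goodStep (hR : ∀ (n : ℕ) (u : Sym2 (Fin n) → unitInterval) (A T : Finset (Fin n)) (b a₀ x s : Fin n) (hb : b ∈ A), Disjoint T A → x ∉ A → x ∉ T → a₀ ∈ A → s ∈ T → (∀ a ∈ A, (prodBernoulli u).real (openConn a₀ b) ≤ (prodBernoulli u).real (openConn a b)) → (prodBernoulli u).real (⋃ v ∈ T, openConn v b) < (prodBernoulli u).real (openConn a₀ b) + (prodBernoulli u).real ((openConn a₀ b)ᶜ ∩ (⋃ v ∈ T, openConn a₀ v) ∩ (⋃ v ∈ T, openConn v b)) → ((prodBernoulli (fun e : Sym2 (Fin n) => if (∀ y ∈ e, y ∈ T) ∧ ¬ e.IsDiag then 1 else u e)).real (openConn s b) + (∑ W ∈ (Finset.univ : Finset (Finset (Fin n))).filter (fun W => s ∈ W ∧ Disjoint W A), (prodBernoulli (fun e : Sym2 (Fin n) => if (∀ y ∈ e, y ∈ T) ∧ ¬ e.IsDiag then 1 else u e)).real {ω : BondConfig (Fin n) | openCluster ω s = (W : Set (Fin n))} * A.inf' ⟨b, hb⟩ (fun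 a => (prodBernoulli (fun e : Sym2 (Fin n) => if (∀ y ∈ e, y ∈ T) ∧ ¬ e.IsDiag then 1 else u e)).real (openConnIn ((W : Set (Fin n))ᶜ) a b))) - (prodBernoulli (fun e : Sym2 (Fin n) => if (∀ y ∈ e, y ∈ T) ∧ ¬ e.IsDiag then 1 else u e)).real (openConn a₀ b)) * (∑ W ∈ (Finset.univ : Finset (Finset (Fin n))).filter (fun W => Disjoint W A), (prodBernoulli (fun e : Sym2 (Fin n) => if (∀ y ∈ e, y ∈ T) ∧ ¬ e.IsDiag then 1 else u e)).real {ω : BondConfig (Fin n) | ∀ z : Fin n, (z ∈ W ↔ ω ∈ ⋃ v ∈ ({s, x} : Finset (Fin n)), openConn v z)} * A.inf' ⟨b, hb⟩ (fun a => (prodBernoulli (fun e : Sym2 (Fin n) => if (∀ y ∈ e, y ∈ T) ∧ ¬ e.IsDiag then 1 else u e)).real (openConnIn ((W : Set (Fin n))ᶜ) a b))) ≤ ((prodBernoulli (fun e : Sym2 (Fin n) => if (∀ y ∈ e, y ∈ T) ∧ ¬ e.IsDiag then 1 else u e)).real (⋃ v ∈ ({s, x} : Finset (Fin n)), openConn v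 b) + (∑ W ∈ (Finset.univ : Finset (Finset (Fin n))).filter (fun W => Disjoint W A), (prodBernoulli (fun e : Sym2 (Fin n) => if (∀ y ∈ e, y ∈ T) ∧ ¬ e.IsDiag then 1 else u e)).real {ω : BondConfig (Fin n) | ∀ z : Fin n, (z ∈ W ↔ ω ∈ ⋃ v ∈ ({s, x} : Finset (Fin n)), openConn v z)} * A.inf' ⟨b, hb⟩ (fun a => (prodBernoulli (fun e : Sym2 (Fin n) => if (∀ y ∈ e, y ∈ T) ∧ ¬ e.IsDiag then 1 else u e)).real (openConnIn ((W : Set (Fin n))ᶜ) a b))) - (prodBernoulli (fun e : Sym2 (Fin n) => if (∀ y ∈ e, y ∈ T) ∧ ¬ e.IsDiag then 1 else u e)).real (openConn a₀ b) - (prodBernoulli (fun e : Sym2 (Fin n) => if (∀ y ∈ e, y ∈ T) ∧ ¬ e.IsDiag then 1 else u e)).real ((openConn a₀ b)ᶜ ∩ (⋃ v ∈ ({s, x} : Finset (Fin n)), openConn a₀ v) ∩ (⋃ v ∈ ({s, x} : Finset (Fin n)), openConn v b))) * (∑ W ∈ (Finset.univ : Finset (Finset (Fin n))).filter (fun W =>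 s ∈ W ∧ Disjoint W A), (prodBernoulli (fun e : Sym2 (Fin n) => if (∀ y ∈ e, y ∈ T) ∧ ¬ e.IsDiag then 1 else u e)).real {ω : BondConfig (Fin n) | openCluster ω s = (W : Set (Fin n))} * A.inf' ⟨b, hb⟩ (fun a => (prodBernoulli (fun e : Sym2 (Fin n) => if (∀ y ∈ e, y ∈ T) ∧ ¬ e.IsDiag then 1 else u e)).real (openConnIn ((W : Set (Fin n))ᶜ) a b)))) :
    ∀ (n : ℕ) (w : Sym2 (Fin n) → unitInterval) (A : Finset (Fin n)) (o b : Fin n),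
      b ∈ A → o ∉ A →
      (∃ y : Fin n, y ∉ A ∧ y ≠ o ∧ (w s(o, y) : ℝ) ≠ 0) →
      (∀ w' : Sym2 (Fin n) → unitInterval,
        (Finset.univ.filter (fun v : Fin n => ∃ u : Fin n, 0 < (w' s(u, v) : ℝ))).card
          < (Finset.univ.filter (fun v : Fin n => ∃ u : Fin n, 0 < (w s(u, v) : ℝ))).card →
        ∀ (A' : Finset (Fin n)) (o' b' : Fin n), b' ∈ A' → o' ∉ A' →
        ∀ (t : ℝ) (sel : Finset (Fin n) → Fin n), (∀ W, sel W ∈ A') →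
          (∀ a ∈ A', 1 - t ≤ (prodBernoulli w').real (openConn a b')) →
          (prodBernoulli w').real ((⋃ a ∈ A', openConn o' a) ∩ (openConn o' b')ᶜ)
            + ∑ W ∈ (Finset.univ : Finset (Finset (Fin n))).filter (fun W => o' ∈ W ∧ Disjoint W A'),
                (prodBernoulli w').real {ω : BondConfig (Fin n) | openCluster ω o' = (W : Set (Fin n))}
                  * (prodBernoulli w').real (openConnIn ((W : Set (Fin n))ᶜ) (sel W) b')ᶜ
            ≤ t) →
      ∀ (t : ℝ) (sel : Finset (Fin n) → Fin n), (∀ W, sel W ∈ A) →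
        (∀ a ∈ A, 1 - t ≤ (prodBernoulli w).real (openConn a b)) →
        (prodBernoulli w).real ((⋃ a ∈ A, openConn o a) ∩ (openConn o b)ᶜ)
          + ∑ W ∈ (Finset.univ : Finset (Finset (Fin n))).filter (fun W => o ∈ W ∧ Disjoint W A),
              (prodBernoulli w).real {ω : BondConfig (Fin n) | openCluster ω o = (W : Set (Fin n))}
                * (prodBernoulli w).real (openConnIn ((W : Set (Fin n))ᶜ) (sel W) b)ᶜ
          ≤ t := by
  intro n w A o b hb ho hlow IH
  obtain ⟨y₀, -, -, hy₀⟩ := id hlow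
  refine goodStep24_main n w A o b hb ho hlow IH ?_
  intro S sel a₀ h2 hoS hSA hSw hsel ha₀ hmin hbad
  set K : Sym2 (Fin n) → unitInterval := fun e => if o ∈ e then (0 : unitInterval) else w e with hK
  obtain ⟨s₀, hs₀⟩ := Finset.card_pos.1 (lt_of_lt_of_le zero_lt_two h2)
  have hs₀A : s₀ ∉ A := Finset.disjoint_left.1 hSA hs₀
  rw [blockGrowth_glue_real_openConn, blockGrowth_glue_real_iUnion K S b]
  simp only [blockGrowth_glue_real_pocket K S]
  have hgood := IH K (goodStep_card_lt w hy₀) A s₀ b hb hs₀A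
  exact peelLine_blockGood K A S b a₀ s₀ (fun W' => sel (insert o W')) hb (fun W' => hsel _) hSA hs₀ h2 ha₀ hmin hbad
    hR hgood


/-- **Every quadruple is good, from `pairGamma`**: strong induction on the number of positive-degree vertices; base = the landed
`stub_goodBase` (with `stub_lemma5AnyRelay`), step = `peelLine_goodStep`.  Proof verbatim from the skeleton's `good_all_of_peel`.
[cite: KozmaNitzan2024, §3.2 pp. 12–14] -/
theorem peelLine_good_all (hR : ∀ (n : ℕ) (u : Sym2 (Fin n) → unitInterval) (A T : Finset (Fin n)) (b a₀ x s : Fin n) (hb : b ∈ A), Disjoint T A → x ∉ A → x ∉ T → a₀ ∈ A → s ∈ T → (∀ a ∈ A, (prodBernoulli u).real (openConn a₀ b) ≤ (prodBernoulli u).real (openConn a b)) → (prodBernoulli u).real (⋃ v ∈ T, openConn v b) < (prodBernoulli u).real (openConn a₀ b) + (prodBernoulli u).real ((openConn a₀ b)ᶜ ∩ (⋃ v ∈ T, openConn a₀ v) ∩ (⋃ v ∈ T, openConn v b)) → ((prodBernoulli (fun e : Sym2 (Fin n) => if (∀ y ∈ e, y ∈ T) ∧ ¬ e.IsDiag then 1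 else u e)).real (openConn s b) + (∑ W ∈ (Finset.univ : Finset (Finset (Fin n))).filter (fun W => s ∈ W ∧ Disjoint W A), (prodBernoulli (fun e : Sym2 (Fin n) => if (∀ y ∈ e, y ∈ T) ∧ ¬ e.IsDiag then 1 else u e)).real {ω : BondConfig (Fin n) | openCluster ω s = (W : Set (Fin n))} * A.inf' ⟨b, hb⟩ (fun a => (prodBernoulli (fun e : Sym2 (Fin n) => if (∀ y ∈ e, y ∈ T) ∧ ¬ e.IsDiag then 1 else u e)).real (openConnIn ((W : Set (Fin n))ᶜ) a b))) - (prodBernoulli (fun e : Sym2 (Fin n) => if (∀ y ∈ e, y ∈ T) ∧ ¬ e.IsDiag then 1 else u e)).real (openConn a₀ b)) * (∑ W ∈ (Finset.univ : Finset (Finset (Fin n))).filter (fun W => Disjoint W A), (prodBernoulli (fun e : Sym2 (Fin n) => if (∀ y ∈ e, y ∈ T) ∧ ¬ e.IsDiag then 1 else u e)).real {ω : BondConfig (Fin n) | ∀ z : Fin n, (z ∈ W ↔ ω ∈ ⋃ v ∈ ({s, x} : Finset (Fin n)), openConn v z)} * A.inf' ⟨b, hb⟩ (fun a => (prodBernoulli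 (fun e : Sym2 (Fin n) => if (∀ y ∈ e, y ∈ T) ∧ ¬ e.IsDiag then 1 else u e)).real (openConnIn ((W : Set (Fin n))ᶜ) a b))) ≤ ((prodBernoulli (fun e : Sym2 (Fin n) => if (∀ y ∈ e, y ∈ T) ∧ ¬ e.IsDiag then 1 else u e)).real (⋃ v ∈ ({s, x} : Finset (Fin n)), openConn v b) + (∑ W ∈ (Finset.univ : Finset (Finset (Fin n))).filter (fun W => Disjoint W A), (prodBernoulli (fun e : Sym2 (Fin n) => if (∀ y ∈ e, y ∈ T) ∧ ¬ e.IsDiag then 1 else u e)).real {ω : BondConfig (Fin n) | ∀ z : Fin n, (z ∈ W ↔ ω ∈ ⋃ v ∈ ({s, x} : Finset (Fin n)), openConn v z)} * A.inf' ⟨b, hb⟩ (fun a => (prodBernoulli (fun e : Sym2 (Fin n) => if (∀ y ∈ e, y ∈ T) ∧ ¬ e.IsDiag then 1 else u e)).real (openConnIn ((W : Set (Fin n))ᶜ) a b))) - (prodBernoulli (fun e : Sym2 (Fin n) => if (∀ y ∈ e, y ∈ T) ∧ ¬ e.IsDiag then 1 else u e)).real (openConn a₀ b) - (prodBernoulli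 (fun e : Sym2 (Fin n) => if (∀ y ∈ e, y ∈ T) ∧ ¬ e.IsDiag then 1 else u e)).real ((openConn a₀ b)ᶜ ∩ (⋃ v ∈ ({s, x} : Finset (Fin n)), openConn a₀ v) ∩ (⋃ v ∈ ({s, x} : Finset (Fin n)), openConn v b))) * (∑ W ∈ (Finset.univ : Finset (Finset (Fin n))).filter (fun W => s ∈ W ∧ Disjoint W A), (prodBernoulli (fun e : Sym2 (Fin n) => if (∀ y ∈ e, y ∈ T) ∧ ¬ e.IsDiag then 1 else u e)).real {ω : BondConfig (Fin n) | openCluster ω s = (W : Set (Fin n))} * A.inf' ⟨b, hb⟩ (fun a => (prodBernoulli (fun e : Sym2 (Fin n) => if (∀ y ∈ e, y ∈ T) ∧ ¬ e.IsDiag then 1 else u e)).real (openConnIn ((W : Set (Fin n))ᶜ) a b))))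
    (n : ℕ) :
    ∀ (w : Sym2 (Fin n) → unitInterval) (A : Finset (Fin n)) (o b : Fin n),
      b ∈ A → o ∉ A →
      ∀ (t : ℝ) (sel : Finset (Fin n) → Fin n), (∀ W, sel W ∈ A) →
        (∀ a ∈ A, 1 - t ≤ (prodBernoulli w).real (openConn a b)) →
        (prodBernoulli w).real ((⋃ a ∈ A, openConn o a) ∩ (openConn o b)ᶜ)
          + ∑ W ∈ (Finset.univ : Finset (Finset (Fin n))).filter (fun W => o ∈ W ∧ Disjoint W A),
              (prodBernoulli w).real {ω : BondConfig (Fin n) | openCluster ω o = (W : Set (Fin n))}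
                * (prodBernoulli w).real (openConnIn ((W : Set (Fin n))ᶜ) (sel W) b)ᶜ
          ≤ t := by
  suffices h : ∀ (k : ℕ) (w : Sym2 (Fin n) → unitInterval),
      (Finset.univ.filter (fun v : Fin n => ∃ u : Fin n, 0 < (w s(u, v) : ℝ))).card = k →
      ∀ (A : Finset (Fin n)) (o b : Fin n),
      b ∈ A → o ∉ A →
      ∀ (t : ℝ) (sel : Finset (Fin n) → Fin n), (∀ W, sel W ∈ A) →
        (∀ a ∈ A, 1 - t ≤ (prodBernoulli w).real (openConn a b)) →
        (prodBernoulli w).real ((⋃ a ∈ A, openConn o a) ∩ (openConn o b)ᶜ)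
          + ∑ W ∈ (Finset.univ : Finset (Finset (Fin n))).filter (fun W => o ∈ W ∧ Disjoint W A),
              (prodBernoulli w).real {ω : BondConfig (Fin n) | openCluster ω o = (W : Set (Fin n))}
                * (prodBernoulli w).real (openConnIn ((W : Set (Fin n))ᶜ) (sel W) b)ᶜ
          ≤ t by
    intro w A o b hb ho
    exact h _ w rfl A o b hb ho
  intro k
  induction k using Nat.strong_induction_on with
  | _ k ih =>
    intro w hk A o b hb ho
    by_cases hiso : ∀ y : Fin n, y ∉ A → y ≠ o → (w s(o, y) : ℝ) = 0
    · exact stub_goodBase stub_lemma5AnyRelay n w A o b hb ho hiso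
    · push Not at hiso
      refine peelLine_goodStep hR n w A o b hb ho hiso ?_
      intro w' hw' A' o' b' hb' ho'
      exact ih _ (hk ▸ hw') w' rfl A' o' b' hb' ho'


/-- **`AdditiveGluing` (its statement, verbatim) from `pairGamma`**: KN's level-set normal form.  Proof verbatim from the
skeleton's `AdditiveGluing_of`. [cite: KozmaNitzan2024, §5.3 p. 34] -/
theorem peelLine_additiveGluing_of (hR : ∀ (n : ℕ) (u : Sym2 (Fin n) → unitInterval) (A T : Finset (Fin n)) (b a₀ x s : Fin n) (hb : b ∈ A), Disjoint T A → x ∉ A → x ∉ T → a₀ ∈ A → s ∈ T → (∀ a ∈ A, (prodBernoulli u).real (openConn a₀ b) ≤ (prodBernoulli u).real (openConn a b)) → (prodBernoulli u).real (⋃ v ∈ T, openConn v b) < (prodBernoulli u).real (openConn a₀ b) + (prodBernoulli u).real ((openConn a₀ b)ᶜ ∩ (⋃ v ∈ T, openConn a₀ v) ∩ (⋃ v ∈ T, openConn v b)) → ((prodBernoulli (fun e : Sym2 (Fin n) => if (∀ y ∈ e, y ∈ T) ∧ ¬ e.IsDiag then 1 else u e)).real (openConn s b) + (∑ W ∈ (Finset.univ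 : Finset (Finset (Fin n))).filter (fun W => s ∈ W ∧ Disjoint W A), (prodBernoulli (fun e : Sym2 (Fin n) => if (∀ y ∈ e, y ∈ T) ∧ ¬ e.IsDiag then 1 else u e)).real {ω : BondConfig (Fin n) | openCluster ω s = (W : Set (Fin n))} * A.inf' ⟨b, hb⟩ (fun a => (prodBernoulli (fun e : Sym2 (Fin n) => if (∀ y ∈ e, y ∈ T) ∧ ¬ e.IsDiag then 1 else u e)).real (openConnIn ((W : Set (Fin n))ᶜ) a b))) - (prodBernoulli (fun e : Sym2 (Fin n) => if (∀ y ∈ e, y ∈ T) ∧ ¬ e.IsDiag then 1 else u e)).real (openConn a₀ b)) * (∑ W ∈ (Finset.univ : Finset (Finset (Fin n))).filter (fun W => Disjoint W A), (prodBernoulli (fun e : Sym2 (Fin n) => if (∀ y ∈ e, y ∈ T) ∧ ¬ e.IsDiag then 1 else u e)).real {ω : BondConfig (Fin n) | ∀ z : Fin n, (z ∈ W ↔ ω ∈ ⋃ v ∈ ({s, x} : Finset (Fin n)), openConn v z)} * A.inf' ⟨b, hb⟩ (fun a => (prodBernoulli (fun e : Sym2 (Fin n) => if (∀ y ∈ e,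 y ∈ T) ∧ ¬ e.IsDiag then 1 else u e)).real (openConnIn ((W : Set (Fin n))ᶜ) a b))) ≤ ((prodBernoulli (fun e : Sym2 (Fin n) => if (∀ y ∈ e, y ∈ T) ∧ ¬ e.IsDiag then 1 else u e)).real (⋃ v ∈ ({s, x} : Finset (Fin n)), openConn v b) + (∑ W ∈ (Finset.univ : Finset (Finset (Fin n))).filter (fun W => Disjoint W A), (prodBernoulli (fun e : Sym2 (Fin n) => if (∀ y ∈ e, y ∈ T) ∧ ¬ e.IsDiag then 1 else u e)).real {ω : BondConfig (Fin n) | ∀ z : Fin n, (z ∈ W ↔ ω ∈ ⋃ v ∈ ({s, x} : Finset (Fin n)), openConn v z)} * A.inf' ⟨b, hb⟩ (fun a => (prodBernoulli (fun e : Sym2 (Fin n) => if (∀ y ∈ e, y ∈ T) ∧ ¬ e.IsDiag then 1 else u e)).real (openConnIn ((W : Set (Fin n))ᶜ) a b))) - (prodBernoulli (fun e : Sym2 (Fin n) => if (∀ y ∈ e, y ∈ T) ∧ ¬ e.IsDiag then 1 else u e)).real (openConn a₀ b) - (prodBernoulli (fun e : Sym2 (Fin n) => if (∀ y ∈ e,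 y ∈ T) ∧ ¬ e.IsDiag then 1 else u e)).real ((openConn a₀ b)ᶜ ∩ (⋃ v ∈ ({s, x} : Finset (Fin n)), openConn a₀ v) ∩ (⋃ v ∈ ({s, x} : Finset (Fin n)), openConn v b))) * (∑ W ∈ (Finset.univ : Finset (Finset (Fin n))).filter (fun W => s ∈ W ∧ Disjoint W A), (prodBernoulli (fun e : Sym2 (Fin n) => if (∀ y ∈ e, y ∈ T) ∧ ¬ e.IsDiag then 1 else u e)).real {ω : BondConfig (Fin n) | openCluster ω s = (W : Set (Fin n))} * A.inf' ⟨b, hb⟩ (fun a => (prodBernoulli (fun e : Sym2 (Fin n) => if (∀ y ∈ e, y ∈ T) ∧ ¬ e.IsDiag then 1 else u e)).real (openConnIn ((W : Set (Fin n))ᶜ) a b)))) :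
    ∀ (n : ℕ) (w : Sym2 (Fin n) → unitInterval) (A : Finset (Fin n)) (o b : Fin n) (t : ℝ), 0 ≤ t →
      (∀ a ∈ A, 1 - t ≤ (prodBernoulli w).real (openConn a b)) →
      (prodBernoulli w).real (⋃ a ∈ A, openConn o a) - t ≤ (prodBernoulli w).real (openConn o b) := by
  intro n w A o b t ht hA
  have hU1 : (prodBernoulli w).real (⋃ a ∈ A, (openConn o a : Set (BondConfig (Fin n)))) ≤ 1 :=
    measureReal_le_one
  have hob0 : 0 ≤ (prodBernoulli w).real (openConn o b : Set (BondConfig (Fin n))) := measureReal_nonneg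
  by_cases ht1 : 1 ≤ t
  · linarith
  push Not at ht1
  have hbb : (prodBernoulli w).real (openConn b b : Set (BondConfig (Fin n))) = 1 := by
    have h : (openConn b b : Set (BondConfig (Fin n))) = Set.univ :=
      Set.eq_univ_of_forall fun ω => (SimpleGraph.Reachable.refl b : (openGraph ω).Reachable b b)
    rw [h, probReal_univ]
  have hbA' : b ∈ Finset.univ.filter (fun x : Fin n => 1 - t ≤ (prodBernoulli w).real (openConn x b)) := by
    rw [Finset.mem_filter]
    refine ⟨Finset.mem_univ _, ?_⟩
    rw [hbb]
    linarith
  have hAA' : ∀ a ∈ A, a ∈ Finset.univ.filter (fun x : Fin n => 1 - t ≤ (prodBernoulli w).real (openConn x b)) :=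
    fun a ha => by
      rw [Finset.mem_filter]
      exact ⟨Finset.mem_univ _, hA a ha⟩
  have hmemA' : ∀ x ∈ Finset.univ.filter (fun x : Fin n => 1 - t ≤ (prodBernoulli w).real (openConn x b)),
      1 - t ≤ (prodBernoulli w).real (openConn x b) := fun x hx => by
    rw [Finset.mem_filter] at hx
    exact hx.2
  by_cases ho : o ∈ Finset.univ.filter (fun x : Fin n => 1 - t ≤ (prodBernoulli w).real (openConn x b))
  · have := hmemA' o ho
    linarith
  have hgood := peelLine_good_all hR n w
    (Finset.univ.filter (fun x : Fin n => 1 - t ≤ (prodBernoulli w).real (openConn x b))) o b hbA' ho t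
    (fun _ => b) (fun _ => hbA') hmemA'
  have hsum : 0 ≤ ∑ W ∈ (Finset.univ : Finset (Finset (Fin n))).filter (fun W => o ∈ W ∧
      Disjoint W (Finset.univ.filter (fun x : Fin n => 1 - t ≤ (prodBernoulli w).real (openConn x b)))),
        (prodBernoulli w).real {ω : BondConfig (Fin n) | openCluster ω o = (W : Set (Fin n))}
          * (prodBernoulli w).real (openConnIn ((W : Set (Fin n))ᶜ) ((fun _ => b) W) b)ᶜ :=
    Finset.sum_nonneg fun W _ => mul_nonneg measureReal_nonneg measureReal_nonneg
  have hlive : (prodBernoulli w).real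
      ((⋃ a ∈ Finset.univ.filter (fun x : Fin n => 1 - t ≤ (prodBernoulli w).real (openConn x b)),
        (openConn o a : Set (BondConfig (Fin n)))) ∩ (openConn o b)ᶜ) ≤ t := by
    linarith
  have hsub : (⋃ a ∈ A, (openConn o a : Set (BondConfig (Fin n)))) ⊆
      ((⋃ a ∈ Finset.univ.filter (fun x : Fin n => 1 - t ≤ (prodBernoulli w).real (openConn x b)),
        (openConn o a : Set (BondConfig (Fin n)))) ∩ (openConn o b)ᶜ) ∪ openConn o b := by
    intro ω hω
    by_cases hb : ω ∈ openConn o b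
    · exact Or.inr hb
    · refine Or.inl ⟨?_, hb⟩
      simp only [Set.mem_iUnion] at hω ⊢
      obtain ⟨a, ha, hωa⟩ := hω
      exact ⟨a, hAA' a ha, hωa⟩
  have hfin := (measureReal_mono (μ := prodBernoulli w) hsub).trans (measureReal_union_le _ _)
  linarith




/-- Registered stub `stub_additiveGluingOfPairGamma_v22472` of crux stmt-CriticalPhenomena-4576: **the crux `AdditiveGluing`
BY NAME from the single inequality `pairGamma`** (fully qualified statement). [cite: KozmaNitzan2024, §3.2 pp. 12–14] -/
theorem stub_additiveGluingOfPairGamma_v22472 : (∀ (n : ℕ) (u : Sym2 (Fin n) → unitInterval) (A T : Finset (Fin n)) (b a₀ x s : Fin n) (hb : b ∈ A), Disjoint T A → x ∉ A → x ∉ T → a₀ ∈ A → s ∈ T → (∀ a ∈ A, (prodBernoulli u).real (openConn a₀ b) ≤ (prodBernoulli u).real (openConn a b)) → (prodBernoulli u).real (⋃ v ∈ T, openConn v b) < (prodBernoulli u).real (openConn a₀ b) + (prodBernoulli u).real ((openConn a₀ b)ᶜ ∩ (⋃ v ∈ T, openConn a₀ v) ∩ (⋃ v ∈ T, openConn v b))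 → ((prodBernoulli (fun e : Sym2 (Fin n) => if (∀ y ∈ e, y ∈ T) ∧ ¬ e.IsDiag then 1 else u e)).real (openConn s b) + (∑ W ∈ (Finset.univ : Finset (Finset (Fin n))).filter (fun W => s ∈ W ∧ Disjoint W A), (prodBernoulli (fun e : Sym2 (Fin n) => if (∀ y ∈ e, y ∈ T) ∧ ¬ e.IsDiag then 1 else u e)).real {ω : BondConfig (Fin n) | openCluster ω s = (W : Set (Fin n))} * A.inf' ⟨b, hb⟩ (fun a => (prodBernoulli (fun e : Sym2 (Fin n) => if (∀ y ∈ e, y ∈ T) ∧ ¬ e.IsDiag then 1 else u e)).real (openConnIn ((W : Set (Fin n))ᶜ) a b))) - (prodBernoulli (fun e : Sym2 (Fin n) => if (∀ y ∈ e, y ∈ T) ∧ ¬ e.IsDiag then 1 else u e)).real (openConn a₀ b)) * (∑ W ∈ (Finset.univ : Finset (Finset (Fin n))).filter (fun W => Disjoint W A), (prodBernoulli (fun e : Sym2 (Fin n) => if (∀ y ∈ e, y ∈ T) ∧ ¬ e.IsDiag then 1 else u e)).real {ω : BondConfig (Fin n) | ∀ z : Fin n, (z ∈ W ↔ ω ∈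 ⋃ v ∈ ({s, x} : Finset (Fin n)), openConn v z)} * A.inf' ⟨b, hb⟩ (fun a => (prodBernoulli (fun e : Sym2 (Fin n) => if (∀ y ∈ e, y ∈ T) ∧ ¬ e.IsDiag then 1 else u e)).real (openConnIn ((W : Set (Fin n))ᶜ) a b))) ≤ ((prodBernoulli (fun e : Sym2 (Fin n) => if (∀ y ∈ e, y ∈ T) ∧ ¬ e.IsDiag then 1 else u e)).real (⋃ v ∈ ({s, x} : Finset (Fin n)), openConn v b) + (∑ W ∈ (Finset.univ : Finset (Finset (Fin n))).filter (fun W => Disjoint W A), (prodBernoulli (fun e : Sym2 (Fin n) => if (∀ y ∈ e, y ∈ T) ∧ ¬ e.IsDiag then 1 else u e)).real {ω : BondConfig (Fin n) | ∀ z : Fin n, (z ∈ W ↔ ω ∈ ⋃ v ∈ ({s, x} : Finset (Fin n)), openConn v z)} * A.inf' ⟨b, hb⟩ (fun a => (prodBernoulli (fun e : Sym2 (Fin n) => if (∀ y ∈ e, y ∈ T) ∧ ¬ e.IsDiag then 1 else u e)).real (openConnIn ((W : Set (Fin n))ᶜ) a b))) - (prodBernoulli (fun e : Sym2 (Fin n)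 => if (∀ y ∈ e, y ∈ T) ∧ ¬ e.IsDiag then 1 else u e)).real (openConn a₀ b) - (prodBernoulli (fun e : Sym2 (Fin n) => if (∀ y ∈ e, y ∈ T) ∧ ¬ e.IsDiag then 1 else u e)).real ((openConn a₀ b)ᶜ ∩ (⋃ v ∈ ({s, x} : Finset (Fin n)), openConn a₀ v) ∩ (⋃ v ∈ ({s, x} : Finset (Fin n)), openConn v b))) * (∑ W ∈ (Finset.univ : Finset (Finset (Fin n))).filter (fun W => s ∈ W ∧ Disjoint W A), (prodBernoulli (fun e : Sym2 (Fin n) => if (∀ y ∈ e, y ∈ T) ∧ ¬ e.IsDiag then 1 else u e)).real {ω : BondConfig (Fin n) | openCluster ω s = (W : Set (Fin n))} * A.inf' ⟨b, hb⟩ (fun a => (prodBernoulli (fun e : Sym2 (Fin n) => if (∀ y ∈ e, y ∈ T) ∧ ¬ e.IsDiag then 1 else u e)).real (openConnIn ((W : Set (Fin n))ᶜ) a b)))) → Summit.CriticalPhenomena.PercolationContinuityZ3.Theses.PercNearOneGluing.AdditiveGluing :=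
  fun hR => peelLine_additiveGluing_of hR

end PeelAssembly

end

end Summit.CriticalPhenomena.PercolationContinuityZ3.Theorems
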